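import Mathlib
import Summits.Ventures.PercRepro2.Defs
import Summits.Ventures.PercRepro2.Harris
import Summits.Ventures.PercRepro2.CoinDefs
import Summits.Ventures.PercRepro2.CoinStarDefs
import Summits.Ventures.PercRepro2.CoinLsmCoreDefs
import Summits.Ventures.PercRepro2.CoinLsmCoreU
import Summits.Ventures.PercRepro2.CoinCoreGate
import Summits.Ventures.PercRepro2.CoinOrTailKDefs
import Summits.Ventures.PercRepro2.CoinOrTailKSums
import Summits.Ventures.PercRepro2.CoinOrTailKAlg
import Summits.Ventures.PercRepro2.CoinOrTailKCore
import Summits.Ventures.PercRepro2.CoinOrTailLsmCore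
import Summits.Ventures.PercRepro2.CoinTreeCore
import Summits.Ventures.PercRepro2.CoinKSureGen
import Summits.Ventures.PercRepro2.CoinKSureTailSums
import Summits.Ventures.PercRepro2.CoinChainCover
import Summits.Ventures.PercRepro2.CoinFourAtomMono

/-!
# The chained OR-vertex with the FIRST MARKER AT THE OR-VERTEX — any number of `a'`-entries
(blind cell PercRepro2, night-2 g17; proofs/NIGHT2-DARC.md §57.8)

The chain `a' → a` of §56 with `a'` entered from ANY set `ent' ⊆ U` by SURE coins and `a` entered
from `a'` (the chain arc, any coin) and possibly from the second marker `m₂`; the markers are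
`a'` itself (`X = 1[a' ∈ S⁺] = 1[W meets ent']`, an increasing `{0,1}` function of the level) and
any `m₂ ∈ U`.  The covering condition of `darc_of_chainCover` is then automatic — a level in
which `X = 0` misses every entry of `a'`, hence cannot reach `a` through `a'` — and the monotone
four-atom sandwich (`fourAtom_functional_nonneg_mono`) closes for EVERY `ent'`, EVERY
log-supermodular core and EVERY head: **`darc_of_chainMarkerA'`** (markers `(a', m₂)`),
**`darc_of_chainMarkerA'_swap`** (`(m₂, a')`), `darc_of_chainTreeMarkerA'`.  This is the
marker-table entry «the marker at the OR-vertex» (§51) for the AND-switch system, with no bound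
on `|ent'|`.  The second level reduction uses `sum_gen_tail` for the marker `1[a' ∈ W]`, which
becomes the entry indicator `entInd ent'` on the levels of `U` (`closeB_of_sure_tail`).
-/

namespace Summit.Ventures.PercRepro2.Coin

open Classical

section ChainMarkerA

variable {V : Type*} {E : Type*} [Fintype V] [DecidableEq V] [Fintype E] [DecidableEq E]
  {R : Type*} [Field R] [LinearOrder R] [IsStrictOrderedRing R]
  {arcs : E → Finset (V × V)} {s : V} {U : Finset V} {ent ent' : Finset V} {c c' : V → E}
  {a a' w : V}

omit [Fintype V] [Fintype E] [DecidableEq E] [Field R] [IsStrictOrderedRing R] in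
/-- `closeB` is monotone in the head. -/
lemma closeB_le_closeB (entb : Finset V) (b : V) {F F' : Finset V → R} (hle : ∀ W, F W ≤ F' W)
    (W : Finset V) : closeB entb b F W ≤ closeB entb b F' W := by
  unfold closeB
  split_ifs <;> exact hle _

omit [Fintype V] [Fintype E] [DecidableEq E] [Field R] [LinearOrder R] [IsStrictOrderedRing R] in
/-- `closeB` on a level missing the entries is the head value. -/
lemma closeB_of_no_entry (entb : Finset V) (b : V) (F : Finset V → R) {W : Finset V}
    (hW : ¬ ∃ r ∈ entb, r ∈ W) : closeB entb b F W = F W := by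
  unfold closeB
  rw [if_neg hW]

/-- **THEOREM (row 2′DARC at a chained OR-vertex, the first marker AT the OR-vertex `a'`).**
`a'` an OR-vertex of `U` entered from ANY `ent' ⊆ U` by SURE coins, `a` an OR-vertex of
`insert a' U` entered from `ent ⊆ {a', m₂}` by ANY coins (the chain arc `a' → a` among them),
`SameEnds`, the cluster law of `U` log-supermodular, `m₂ ∈ U`, `t, w ∉ U ∪ {a, a', s}` ⟹
`DARC pr arcs s {t} a' m₂ a w` — every head, every probability vector, no bound on `|ent'|`. -/
theorem darc_of_chainMarkerA' (pr : E → R) (hp : IsProbVec pr) (hS : SameEnds arcs)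
    (h' : OrTailK arcs s U ent' c' a') (h : OrTailK arcs s (insert a' U) ent c a)
    (hsure : ∀ r ∈ ent', pr (c' r) = 1)
    {m₂ : V} (hm₂ : m₂ ∈ U) (hcov : ∀ r ∈ ent, r = a' ∨ r = m₂)
    (hν : ∀ W W', W ⊆ U → W' ⊆ U →
      prob pr (coreLevel arcs s U W) * prob pr (coreLevel arcs s U W') ≤
        prob pr (coreLevel arcs s U (W ∩ W')) * prob pr (coreLevel arcs s U (W ∪ W')))
    {t : V} (htC : t ∉ insert a (insert a' U)) (hts : t ≠ s) (hws : w ≠ s)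
    (hwC : w ∉ insert a (insert a' U)) :
    DARC pr arcs s {t} a' m₂ a w := by
  have hC := h.closedInCoreU
  have ha'U : a' ∉ U := h'.a_notin
  have haU' : a ∉ insert a' U := h.a_notin
  have ha'a : a' ≠ a := fun e => haU' (e ▸ Finset.mem_insert_self a' U)
  have hm₂a : m₂ ≠ a := fun e => haU' (e ▸ Finset.mem_insert_of_mem hm₂)
  have hm₂a' : m₂ ≠ a' := fun e => ha'U (e ▸ hm₂)
  have ha'C : a' ∈ insert a (insert a' U) := Finset.mem_insert_of_mem (Finset.mem_insert_self _ _)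
  have hm₂C : m₂ ∈ insert a (insert a' U) :=
    Finset.mem_insert_of_mem (Finset.mem_insert_of_mem hm₂)
  have haC : a ∈ insert a (insert a' U) := Finset.mem_insert_self _ _
  unfold DARC
  rw [hC.phiC_gate_eq pr hS htC hts ha'C hm₂C haC hws hwC]
  -- the marker functions and their invariances under `insert a`
  have hm1 : ∀ W : Finset V, (fun _ : Finset V => (1 : R)) (insert a W) = (fun _ => (1 : R)) W :=
    fun _ => rfl
  have hm1' : ∀ W : Finset V, (fun _ : Finset V => (1 : R)) (insert a' W) = (fun _ => (1 : R)) W :=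
    fun _ => rfl
  have hxa : ∀ W : Finset V, (fun W : Finset V => if a' ∈ W then (1 : R) else 0) (insert a W) =
      (fun W : Finset V => if a' ∈ W then (1 : R) else 0) W := by
    intro W; simp only [Finset.mem_insert, ha'a, false_or]
  have hya : ∀ W : Finset V, (fun W : Finset V => if m₂ ∈ W then (1 : R) else 0) (insert a W) =
      (fun W : Finset V => if m₂ ∈ W then (1 : R) else 0) W := by
    intro W; simp only [Finset.mem_insert, hm₂a, false_or]
  have hya' : ∀ W : Finset V, (fun W : Finset V => if m₂ ∈ W then (1 : R) else 0) (insert a' W) =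
      (fun W : Finset V => if m₂ ∈ W then (1 : R) else 0) W := by
    intro W; simp only [Finset.mem_insert, hm₂a', false_or]
  have hxya : ∀ W : Finset V,
      (fun W : Finset V => (if a' ∈ W then (1 : R) else 0) * (if m₂ ∈ W then (1 : R) else 0))
        (insert a W) =
      (fun W : Finset V => (if a' ∈ W then (1 : R) else 0) * (if m₂ ∈ W then (1 : R) else 0)) W := by
    intro W; simp only [Finset.mem_insert, ha'a, hm₂a, false_or]
  -- the marker `1[a' ∈ W]` vanishes off `a'` and is `1` on `insert a' W`
  have hg0 : ∀ W : Finset V, a' ∉ W →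
      (fun W : Finset V => if a' ∈ W then (1 : R) else 0) W = 0 := by
    intro W hW; simp only [hW, if_false]
  have hg1 : ∀ W : Finset V, a' ∉ W →
      (fun W : Finset V => if a' ∈ W then (1 : R) else 0) (insert a' W) = (fun _ => (1 : R)) W := by
    intro W _; simp only [Finset.mem_insert_self, if_true]
  have hq0 : ∀ W : Finset V, a' ∉ W →
      (fun W : Finset V => (if a' ∈ W then (1 : R) else 0) * (if m₂ ∈ W then (1 : R) else 0)) W
        = 0 := by
    intro W hW; simp only [hW, if_false, zero_mul]
  have hq1 : ∀ W : Finset V, a' ∉ W →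
      (fun W : Finset V => (if a' ∈ W then (1 : R) else 0) * (if m₂ ∈ W then (1 : R) else 0))
          (insert a' W) =
        (fun W : Finset V => if m₂ ∈ W then (1 : R) else 0) W := by
    intro W _
    simp only [Finset.mem_insert_self, if_true, one_mul, Finset.mem_insert, hm₂a', false_or]
  -- the level reduction over `a` (core `insert a' U`)
  have eΛ := h.sum_R_eq pr t (fun _ => (1 : R)) hm1
  have eFa := h.sum_R_eq pr t (fun W => if a' ∈ W then (1 : R) else 0) hxa
  have eFb := h.sum_R_eq pr t (fun W => if m₂ ∈ W then (1 : R) else 0) hya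
  have eM := h.sum_G_eq (w := w) pr t (fun _ => (1 : R)) hm1
  have eX := h.sum_G_eq (w := w) pr t (fun W => if a' ∈ W then (1 : R) else 0) hxa
  have eY := h.sum_G_eq (w := w) pr t (fun W => if m₂ ∈ W then (1 : R) else 0) hya
  have eXY := h.sum_G_eq (w := w) pr t
    (fun W => (if a' ∈ W then (1 : R) else 0) * (if m₂ ∈ W then (1 : R) else 0)) hxya
  simp only [mul_one] at eΛ eM
  rw [eΛ, eFa, eFb, eM, eX, eY, eXY]
  set A : Finset V → R := fun X => prob pr (coreAvoidEvent arcs s t (insert a (insert a' U)) X)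
    with hAdef
  obtain ⟨hA0, hAmono, hAlsm⟩ := OrTailU.head_props (U := insert a' U) (a := a) pr hp hS t
  have hp0 := hp.nonneg
  have hp1 := hp.le_one
  set FR : Finset V → R := rValK A pr ent c a with hFR
  set FG : Finset V → R := gValK A pr ent c a w with hFG
  -- the level reduction over `a'` (core `U`): `sum_gen` for the markers constant in `a'`,
  -- `sum_gen_tail` for the marker `1[a' ∈ W]`
  have fΛ := h'.sum_gen pr FR (fun _ => (1 : R)) hm1'
  have fFa := h'.sum_gen_tail pr FR (fun W => if a' ∈ W then (1 : R) else 0) (fun _ => (1 : R))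
    hg0 hg1
  have fFb := h'.sum_gen pr FR (fun W => if m₂ ∈ W then (1 : R) else 0) hya'
  have fM := h'.sum_gen pr FG (fun _ => (1 : R)) hm1'
  have fX := h'.sum_gen_tail pr FG (fun W => if a' ∈ W then (1 : R) else 0) (fun _ => (1 : R))
    hg0 hg1
  have fY := h'.sum_gen pr FG (fun W => if m₂ ∈ W then (1 : R) else 0) hya'
  have fXY := h'.sum_gen_tail pr FG
    (fun W => (if a' ∈ W then (1 : R) else 0) * (if m₂ ∈ W then (1 : R) else 0))
    (fun W => if m₂ ∈ W then (1 : R) else 0) hq0 hq1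
  simp only [mul_one] at fΛ fFa fM fX
  rw [fΛ, fFa, fFb, fM, fX, fY, fXY]
  -- the sure-coin mixtures are the OR-closures, the entered parts the closures times the entry
  -- indicator
  set ν : Finset V → R := fun W => prob pr (coreLevel arcs s U W) with hνdef
  have hν0 : ∀ W, 0 ≤ ν W := fun W => prob_nonneg hp _
  set x : Finset V → R := fun W => if ∃ r ∈ ent', r ∈ W then (1 : R) else 0 with hxdef
  set y : Finset V → R := fun W => if m₂ ∈ W then (1 : R) else 0 with hydef
  set G : Finset V → R := fun W => ν W * closeB ent' a' FR W with hGdef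
  set G' : Finset V → R := fun W => ν W * closeB ent' a' FG W with hG'def
  have cΛ : (∑ W ∈ U.powerset, ν W *
      (tailWtK pr ent' c' W * FR W + (1 - tailWtK pr ent' c' W) * FR (W ∪ {a'}))) =
      ∑ W ∈ U.powerset, G W :=
    Finset.sum_congr rfl fun W _ => by
      simp only [hGdef]; rw [closeB_of_sure pr c' a' FR hsure W]
  have cFa : (∑ W ∈ U.powerset, ν W * ((1 - tailWtK pr ent' c' W) * FR (W ∪ {a'}))) =
      ∑ W ∈ U.powerset, G W * x W :=
    Finset.sum_congr rfl fun W _ => by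
      simp only [hGdef, hxdef]; rw [closeB_of_sure_tail pr c' a' FR hsure W]; ring
  have cFb : (∑ W ∈ U.powerset, ν W *
      (tailWtK pr ent' c' W * FR W + (1 - tailWtK pr ent' c' W) * FR (W ∪ {a'})) *
        (if m₂ ∈ W then (1 : R) else 0)) = ∑ W ∈ U.powerset, G W * y W :=
    Finset.sum_congr rfl fun W _ => by
      simp only [hGdef, hydef]; rw [closeB_of_sure pr c' a' FR hsure W]
  have cM : (∑ W ∈ U.powerset, ν W *
      (tailWtK pr ent' c' W * FG W + (1 - tailWtK pr ent' c' W) * FG (W ∪ {a'}))) =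
      ∑ W ∈ U.powerset, G' W :=
    Finset.sum_congr rfl fun W _ => by
      simp only [hG'def]; rw [closeB_of_sure pr c' a' FG hsure W]
  have cX : (∑ W ∈ U.powerset, ν W * ((1 - tailWtK pr ent' c' W) * FG (W ∪ {a'}))) =
      ∑ W ∈ U.powerset, G' W * x W :=
    Finset.sum_congr rfl fun W _ => by
      simp only [hG'def, hxdef]; rw [closeB_of_sure_tail pr c' a' FG hsure W]; ring
  have cY : (∑ W ∈ U.powerset, ν W *
      (tailWtK pr ent' c' W * FG W + (1 - tailWtK pr ent' c' W) * FG (W ∪ {a'})) *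
        (if m₂ ∈ W then (1 : R) else 0)) = ∑ W ∈ U.powerset, G' W * y W :=
    Finset.sum_congr rfl fun W _ => by
      simp only [hG'def, hydef]; rw [closeB_of_sure pr c' a' FG hsure W]
  have cXY : (∑ W ∈ U.powerset, ν W * ((1 - tailWtK pr ent' c' W) * FG (W ∪ {a'})) *
        (if m₂ ∈ W then (1 : R) else 0)) = ∑ W ∈ U.powerset, G' W * (x W * y W) :=
    Finset.sum_congr rfl fun W _ => by
      simp only [hG'def, hxdef, hydef]; rw [closeB_of_sure_tail pr c' a' FG hsure W]; ring
  rw [cΛ, cFa, cFb, cM, cX, cY, cXY]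
  -- the hypotheses of the monotone four-atom sandwich
  have hFR0 : ∀ W, 0 ≤ FR W := fun W => rValK_nonneg hp0 hp1 hA0 ent c a W
  have hFG0 : ∀ W, 0 ≤ FG W := fun W => gValK_nonneg hp0 hp1 hA0 ent c a w W
  have hFRlsm : ∀ s t : Finset V, FR s * FR t ≤ FR (s ∩ t) * FR (s ∪ t) :=
    fun s t => rValK_mul_le_all A pr ent c a hp0 hp1 hA0 hAlsm hAmono s t
  have hFGlsm : ∀ s t : Finset V, FG s * FG t ≤ FG (s ∩ t) * FG (s ∪ t) :=
    fun s t => gValK_mul_le_all A pr ent c a w hp0 hp1 hA0 hAlsm hAmono s t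
  have hFRmono : ∀ s t : Finset V, s ⊆ t → FR t ≤ FR s :=
    fun s t hst => rValK_antitone hp0 hp1 hAmono ent c a hst
  have hFGmono : ∀ s t : Finset V, s ⊆ t → FG t ≤ FG s :=
    fun s t hst => gValK_antitone hp0 hp1 hAmono ent c a w hst
  have hFGle : ∀ W, FG W ≤ FR W := fun W => gValK_le_rValK hp0 hp1 hAmono ent c a w W
  have hG0 : ∀ W, 0 ≤ G W := fun W => mul_nonneg (hν0 W) (closeB_nonneg ent' a' FR hFR0 W)
  have hG'0 : ∀ W, 0 ≤ G' W := fun W => mul_nonneg (hν0 W) (closeB_nonneg ent' a' FG hFG0 W)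
  have hx01 : ∀ W, x W = 0 ∨ x W = 1 := by
    intro W; simp only [hxdef]; split_ifs <;> simp
  have hy01 : ∀ W, y W = 0 ∨ y W = 1 := by
    intro W; simp only [hydef]; split_ifs <;> simp
  have hxm : ∀ s t : Finset V, s ⊆ t → x s ≤ x t := by
    intro s t hst
    simp only [hxdef]
    by_cases hs : ∃ r ∈ ent', r ∈ s
    · obtain ⟨r, hr, hrs⟩ := hs
      rw [if_pos ⟨r, hr, hrs⟩, if_pos ⟨r, hr, hst hrs⟩]
    · rw [if_neg hs]; split_ifs <;> norm_num
  have hym : ∀ s t : Finset V, s ⊆ t → y s ≤ y t := by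
    intro s t hst
    simp only [hydef]
    by_cases hs : m₂ ∈ s
    · rw [if_pos hs, if_pos (hst hs)]
    · rw [if_neg hs]; split_ifs <;> norm_num
  have wLL : ∀ s ⊆ U, ∀ t ⊆ U, G s * G t ≤ G (s ∩ t) * G (s ∪ t) := by
    intro s hs t ht
    have hs' : a' ∉ s := fun hx => ha'U (hs hx)
    have ht' : a' ∉ t := fun hx => ha'U (ht hx)
    simp only [hGdef]
    calc ν s * closeB ent' a' FR s * (ν t * closeB ent' a' FR t)
        = (ν s * ν t) * (closeB ent' a' FR s * closeB ent' a' FR t) := by ring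
      _ ≤ (ν (s ∩ t) * ν (s ∪ t)) * (closeB ent' a' FR (s ∩ t) * closeB ent' a' FR (s ∪ t)) :=
          mul_le_mul (hν s t hs ht) (closeB_lsm ent' a' FR hFR0 hFRlsm hFRmono hs' ht')
            (mul_nonneg (closeB_nonneg ent' a' FR hFR0 _) (closeB_nonneg ent' a' FR hFR0 _))
            (mul_nonneg (hν0 _) (hν0 _))
      _ = _ := by ring
  have wMM : ∀ s ⊆ U, ∀ t ⊆ U, G' s * G' t ≤ G' (s ∩ t) * G' (s ∪ t) := by
    intro s hs t ht
    have hs' : a' ∉ s := fun hx => ha'U (hs hx)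
    have ht' : a' ∉ t := fun hx => ha'U (ht hx)
    simp only [hG'def]
    calc ν s * closeB ent' a' FG s * (ν t * closeB ent' a' FG t)
        = (ν s * ν t) * (closeB ent' a' FG s * closeB ent' a' FG t) := by ring
      _ ≤ (ν (s ∩ t) * ν (s ∪ t)) * (closeB ent' a' FG (s ∩ t) * closeB ent' a' FG (s ∪ t)) :=
          mul_le_mul (hν s t hs ht) (closeB_lsm ent' a' FG hFG0 hFGlsm hFGmono hs' ht')
            (mul_nonneg (closeB_nonneg ent' a' FG hFG0 _) (closeB_nonneg ent' a' FG hFG0 _))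
            (mul_nonneg (hν0 _) (hν0 _))
      _ = _ := by ring
  have hle : ∀ W ∈ U.powerset, G' W ≤ G W := fun W _ =>
    mul_le_mul_of_nonneg_left (closeB_le_closeB ent' a' hFGle W) (hν0 W)
  have h00 : ∀ W ∈ U.powerset, x W = 0 → y W = 0 → G' W = G W := by
    intro W hW hx hy
    have hWU : W ⊆ U := Finset.mem_powerset.1 hW
    have ha'W : a' ∉ W := fun hx => ha'U (hWU hx)
    have hno' : ¬ ∃ r ∈ ent', r ∈ W := by
      intro hex
      simp only [hxdef, if_pos hex] at hx
      exact one_ne_zero hx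
    have hm₂W : m₂ ∉ W := by
      intro hmem
      simp only [hydef, if_pos hmem] at hy
      exact one_ne_zero hy
    have hno : ∀ r ∈ ent, r ∉ W := by
      intro r hr hrW
      rcases hcov r hr with rfl | rfl
      · exact ha'W hrW
      · exact hm₂W hrW
    simp only [hGdef, hG'def]
    rw [closeB_of_no_entry ent' a' FR hno', closeB_of_no_entry ent' a' FG hno']
    simp only [hFR, hFG]
    rw [gValK_eq_rValK_of_no_entry A pr c a w hno]
  exact fourAtom_functional_nonneg_mono U G G' x y hG0 hG'0 hx01 hy01 hxm hym wLL wMM hle h00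

/-- **The mirror: markers `(m₂, a')`.** -/
theorem darc_of_chainMarkerA'_swap (pr : E → R) (hp : IsProbVec pr) (hS : SameEnds arcs)
    (h' : OrTailK arcs s U ent' c' a') (h : OrTailK arcs s (insert a' U) ent c a)
    (hsure : ∀ r ∈ ent', pr (c' r) = 1)
    {m₂ : V} (hm₂ : m₂ ∈ U) (hcov : ∀ r ∈ ent, r = a' ∨ r = m₂)
    (hν : ∀ W W', W ⊆ U → W' ⊆ U →
      prob pr (coreLevel arcs s U W) * prob pr (coreLevel arcs s U W') ≤
        prob pr (coreLevel arcs s U (W ∩ W')) * prob pr (coreLevel arcs s U (W ∪ W')))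
    {t : V} (htC : t ∉ insert a (insert a' U)) (hts : t ≠ s) (hws : w ≠ s)
    (hwC : w ∉ insert a (insert a' U)) :
    DARC pr arcs s {t} m₂ a' a w :=
  (darc_swap pr arcs s {t} a' m₂ a w).1
    (darc_of_chainMarkerA' pr hp hS h' h hsure hm₂ hcov hν htC hts hws hwC)

/-- **COROLLARY (out-tree core).** -/
theorem darc_of_chainTreeMarkerA' (pr : E → R) (hp : IsProbVec pr) (hS : SameEnds arcs)
    (h' : OrTailK arcs s U ent' c' a') (h : OrTailK arcs s (insert a' U) ent c a)
    {cT : V → E} {par : V → V} {rk : V → ℕ} (hT : TreeCore arcs s U cT par rk)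
    (hsure : ∀ r ∈ ent', pr (c' r) = 1)
    {m₂ : V} (hm₂ : m₂ ∈ U) (hcov : ∀ r ∈ ent, r = a' ∨ r = m₂)
    {t : V} (htC : t ∉ insert a (insert a' U)) (hts : t ≠ s) (hws : w ≠ s)
    (hwC : w ∉ insert a (insert a' U)) :
    DARC pr arcs s {t} a' m₂ a w :=
  darc_of_chainMarkerA' pr hp hS h' h hsure hm₂ hcov (hT.coreLevel_lsm pr hp) htC hts hws hwC

end ChainMarkerA

end Summit.Ventures.PercRepro2.Coin
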